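import Summits.ABC.ABC.Theses.DefiniteXi
import Literature.NumberTheory.EllipticCurves.TateCurve.NumberFieldUniformizationTwisted
import Literature.NumberTheory.EllipticCurves.OpenImageMazurTwistProofs
import Literature.NumberTheory.EllipticCurves.SelmerInertiaProofs
import Literature.NumberTheory.EllipticCurves.OpenImageMazurNumericsProofs
import HarnessLib

/-!
# Stub-ideation k=3 (gen 4, FAMILY 3 — PROBE THE EXTREMES) for `stub_pasten163`
# — crux `DefiniteRTControlPrime` (stmt-ABC-11338)

Companion to `STUB-IDEAS-stub_pasten163-3.md` (gen 4).  Scratch check that the gen-4 helper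
STATEMENTS elaborate; `sorry` = helper for the stub prover; the `X*` items are kernel-checked
(`decide`) extremal witnesses / test vectors, not helpers.

Plan A (verbatim stub) needs no helper: `PastenShimura2024_minimalDegree_le_163_mul` is the route
item `MazurKenkuBound` (stmt-ABC-15125) by `Iff.rfl`; import
`Summit.ABC.ABC.Theorems.mazurKenkuBound_of_radiusItem` / `…_of_cor44_of_jTables_of_liteLevels6`.

Plan B (Mazur-free RESHAPE through the cyclic-isogeny diameter at HALF level, k2 gen-3 cut
`Lines/StubIdeasK2g3_pasten163.lean`): this file supplies
* `X1a/X1b` — the half level is SHARP locally (unipotent inertia, `(ℤ/9)²`) and the filtration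
  dichotomy D1 is EXACT when `x − y` is a unit (same module, `τ₀ = (2 *; 0 1)`);
* `D3loc` + `D3glob` — k2g3's hardest helper D3 (`exists_multiplicativeFiltration`) cut in two:
  a purely LOCAL statement over `ℚ_v` read off the PROVED twisted Tate uniformisation
  (`Silverman1994_thmV53_corV54_tateUniformisation_holds`, valid for the whole decomposition group
  and for EVERY residue characteristic, also `v ∣ ℓ`), and a 15-line global transport
  (pattern `WeierstrassCurve.smul_smul_sub_eq_of_mem_inertia_geomPoints`);
* `CycRes` — the one genuinely new XS input of both D2 and D3: the mod-`N` cyclotomic character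
  commutes with `resGalOfEmb ι`;
* `X2` — `decide`d Frobenius-norm test vectors for H5/C0 (`11a`: `25 ∣ n₁₂(3)`; `14a`: `9 ∣ n₁₂(5)`).
-/

namespace Summit.ABC.ABC.Cruxes.DefiniteRTControlPrime.Sketch.Ideas3g4

open Literature.NumberTheory.EllipticCurves Literature.NumberTheory.GaloisRepresentations
open WeierstrassCurve IsDedekindDomain NumberField Field

/-! ## X1 — extremal witnesses on `(ℤ/9)²` (kernel-checked) -/

set_option maxRecDepth 4000 in
/-- X1a (sharpness of the HALF level; no helper).  The additive map `τ(x₁,x₂) = (x₁ + x₂, x₂)` is unipotent with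
`(τ − 1)² = 0` — the shape of tame inertia on `E[9]` at a multiplicative `p ≠ 3` with
`3 ∤ v_p(Δ)` (Tate basis `ζ₉, q^{1/9}`).  The order-`9` point `P = (1,3)` (`= ζ₉·q^{1/3}`, the
MIXED line: `⟨P⟩ ∩ μ₉ = μ₃`) spans a `τ`-stable line with eigenvalue `4`: `≡ 1 (mod 3)`,
`≢ 1 (mod 9)`.  Hence k2g3 U1/U2 (`r̄(τ) = 1` only modulo `ℓ^⌈k/2⌉`) and C1 (`d ∣ n²`) are sharp
for the local method; realised over `ℚ` by `11a3 → 11a1 → 11a2` (`ℓᵏ = 25`, `v₁₁(Δ) = 1, 5, 1`). -/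
theorem X1a_halfLevel_sharp :
    let τ : ZMod 9 × ZMod 9 → ZMod 9 × ZMod 9 := fun x => (x.1 + x.2, x.2)
    let P : ZMod 9 × ZMod 9 := (1, 3)
    (∀ x, τ (τ x) - 2 • τ x + x = 0) ∧
      τ P = (4 : ZMod 9) • P ∧ 9 • P = 0 ∧ 3 • P ≠ 0 ∧
      (4 : ZMod 9) ≠ 1 ∧ (((4 : ZMod 9).val : ℕ) : ZMod 3) = 1 := by
  decide

/-- X1b (positive control for D1 `filtration_dichotomy`; no helper).  With `E₁ = ℤ/9 × 0`,
`τ₀(x₁,x₂) = (2x₁ + x₂, x₂)` acts by `x = 2` on `E₁` and by `y = 1` modulo `E₁`, `x − y` a unit: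
EVERY `τ₀`-stable line of order `9` has eigenvalue exactly `2` or exactly `1` (full level). -/
theorem X1b_dichotomy_exact :
    let τ : ZMod 9 × ZMod 9 → ZMod 9 × ZMod 9 := fun x => (2 * x.1 + x.2, x.2)
    ∀ P : ZMod 9 × ZMod 9, 3 • P ≠ 0 → ∀ lam : ZMod 9, τ P = lam • P → lam = 2 ∨ lam = 1 := by
  decide

/-! ## D3, cut in two: LOCAL Tate read-off + global transport -/

/-- The local toric filtration at a multiplicative place (any residue characteristic):
`E₁ = Ψ(μ_∞) ≤ E(ℚ̄_v)`, signs `s = χ_t` (the twist character of V.5.2 (c)), and for EVERY `σ` in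
the local Galois group: `σ` acts on `E₁[ℓᵏ]` by `s(σ)·χ_{ℓᵏ}(σ)` and by `s(σ)` modulo `E₁` on
`E[ℓᵏ]`. -/
def LocalToricFiltration (W : WeierstrassCurve ℚ) (v : HeightOneSpectrum (𝓞 ℚ)) (ℓ k : ℕ)
    [NeZero (ℓ ^ k)] [NeZero ((ℓ ^ k : ℕ) : v.adicCompletion ℚ)] : Prop :=
  ∃ (E₁ : AddSubgroup (localPoints W (v.adicCompletion ℚ)))
    (s : absoluteGaloisGroup (v.adicCompletion ℚ) → ℤ),
    (∀ σ, s σ = 1 ∨ s σ = -1) ∧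
    (∀ σ, ∀ Q ∈ E₁, ℓ ^ k • Q = 0 →
      σ • Q = (s σ * ((((modNCyclotomicCharacter (v.adicCompletion ℚ) (ℓ ^ k) σ :
        (ZMod (ℓ ^ k))ˣ) : ZMod (ℓ ^ k)).val : ℤ))) • Q) ∧
    (∀ σ, ∀ Q : localPoints W (v.adicCompletion ℚ), ℓ ^ k • Q = 0 → σ • Q - s σ • Q ∈ E₁)

/-- k2g3's D3 conclusion, verbatim, as a `Prop` (so that `D3glob` is literally `D3loc → D3`). -/
def MultiplicativeFiltrationAt (W : WeierstrassCurve ℚ) (ℓ k : ℕ) [NeZero (ℓ ^ k)]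
    (𝔓 : Ideal (absIntegers (𝓞 ℚ) ℚ)) : Prop :=
  ∃ (E₁ : AddSubgroup (geomPoints W)) (s : absoluteGaloisGroup ℚ → ℤ),
    (∀ τ, s τ = 1 ∨ s τ = -1) ∧
    (∀ τ ∈ 𝔓.inertia (absoluteGaloisGroup ℚ), ∀ Q ∈ E₁, ℓ ^ k • Q = 0 →
      τ • Q = (s τ * ((((modNCyclotomicCharacter ℚ (ℓ ^ k) τ : (ZMod (ℓ ^ k))ˣ) :
        ZMod (ℓ ^ k)).val : ℤ))) • Q) ∧
    (∀ τ ∈ 𝔓.inertia (absoluteGaloisGroup ℚ), ∀ Q : geomPoints W, ℓ ^ k • Q = 0 →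
      τ • Q - s τ • Q ∈ E₁)

/-- D3loc (M, ONE cycle, pure Tate read-off — no reduction theory, no `ℓ ≠ 2`, no `v ∣ ℓ`):
from `Silverman1994_thmV53_corV54_tateUniformisation_holds W v hv` take `q, t, Ψ`; put
`E₁ := Ψ(Additive.ofMul '' torsion (K̄_vˣ))` and `s σ := if toAlgEquiv σ t = t then 1 else −1`.
(i) `Q = Ψ(ζ) ∈ E₁`, `ℓᵏQ = 0 ⇒ ζ^{ℓᵏ} ∈ q^ℤ ∩ μ_∞ = 1` (`Valued.v q < 1`), and
`σ•Ψ(ζ) = s(σ)Ψ(σζ) = s(σ)Ψ(ζ^{χ(σ)})` (`modNCyclotomicCharacter_spec`);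
(ii) `Q = Ψ(u)`, `u^{ℓᵏ} = q^n ⇒ (σu/u)^{ℓᵏ} = 1`, so `σ•Q − s(σ)Q = s(σ)Ψ(σu/u) ∈ E₁`. -/
theorem D3loc_localToricFiltration (W : WeierstrassCurve ℚ) [W.IsElliptic]
    {v : HeightOneSpectrum (𝓞 ℚ)} (hv : W.HasMultiplicativeReductionAt v) (ℓ k : ℕ)
    [Fact ℓ.Prime] [NeZero ((ℓ ^ k : ℕ) : v.adicCompletion ℚ)] :
    LocalToricFiltration W v ℓ k := by
  sorry

/-- CycRes (XS, the shared new input of D2 and D3): the mod-`N` cyclotomic character commutes with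
restriction along an embedding `ι : ℚ̄ → ℚ̄_v` (both sides are pinned by the action on one primitive
`N`-th root of unity: `modNCyclotomicCharacter_spec` + `modNCyclotomicCharacter_eq_of_smul_eq_pow`,
`ι (res σ • ζ) = σ • ι ζ` from `comp_resGalAuxOfEmb`). -/
theorem CycRes_modNCyclotomicCharacter_resGalOfEmb (N : ℕ) [NeZero N]
    {v : HeightOneSpectrum (𝓞 ℚ)} [NeZero ((N : ℕ) : v.adicCompletion ℚ)]
    (ι : AlgebraicClosure ℚ →ₐ[ℚ] AlgebraicClosure (v.adicCompletion ℚ))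
    (σ : absoluteGaloisGroup (v.adicCompletion ℚ)) :
    modNCyclotomicCharacter ℚ N (resGalOfEmb ι σ) =
      modNCyclotomicCharacter (v.adicCompletion ℚ) N σ := by
  sorry

/-- D3glob (S/M, ONE cycle, the transport; pattern = the 15 lines of
`WeierstrassCurve.smul_smul_sub_eq_of_mem_inertia_geomPoints`): choose `ι, 𝔐` with
`𝔓 = v.primeBelow ι 𝔐` (`exists_smul_eq_of_mem_primesAbove_holds`), pull `E₁` back along the
injective `pointsMapOfEmb W ι`, and for `τ ∈ I_𝔓` pick `σ ∈ I_𝔐` with `ι (τ•x) = σ•ι x`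
(`IsDedekindDomain.HeightOneSpectrum.exists_mem_inertia_apply_eq_holds`), so `resGalOfEmb ι σ = τ`
(`resGalOfEmb_eq_of_apply_eq`), `pointsMapOfEmb_smul`, and `CycRes`; `s τ := s_loc σ(τ)` on `I_𝔓`,
`1` elsewhere. -/
theorem D3glob_multiplicativeFiltrationAt_of_local (W : WeierstrassCurve ℚ) [W.IsElliptic]
    {v : HeightOneSpectrum (𝓞 ℚ)} (ℓ k : ℕ) [Fact ℓ.Prime]
    [NeZero ((ℓ ^ k : ℕ) : v.adicCompletion ℚ)] (hloc : LocalToricFiltration W v ℓ k)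
    {𝔓 : Ideal (absIntegers (𝓞 ℚ) ℚ)} (h𝔓 : 𝔓 ∈ v.primesAbove) :
    MultiplicativeFiltrationAt W ℓ k 𝔓 := by
  sorry

/-- D3 recovered (k2g3 `exists_multiplicativeFiltration`, with its unused hypotheses `ℓ ≠ 2`,
`v ∣ ℓ` dropped): composition, no `sorry` of its own. -/
theorem D3_exists_multiplicativeFiltration (W : WeierstrassCurve ℚ) [W.IsElliptic]
    {v : HeightOneSpectrum (𝓞 ℚ)} (hv : W.HasMultiplicativeReductionAt v) (ℓ k : ℕ)
    [Fact ℓ.Prime] [NeZero ((ℓ ^ k : ℕ) : v.adicCompletion ℚ)]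
    {𝔓 : Ideal (absIntegers (𝓞 ℚ) ℚ)} (h𝔓 : 𝔓 ∈ v.primesAbove) :
    ∃ (E₁ : AddSubgroup (geomPoints W)) (s : absoluteGaloisGroup ℚ → ℤ),
      (∀ τ, s τ = 1 ∨ s τ = -1) ∧
      (∀ τ ∈ 𝔓.inertia (absoluteGaloisGroup ℚ), ∀ Q ∈ E₁, ℓ ^ k • Q = 0 →
        τ • Q = (s τ * ((((modNCyclotomicCharacter ℚ (ℓ ^ k) τ : (ZMod (ℓ ^ k))ˣ) :
          ZMod (ℓ ^ k)).val : ℤ))) • Q) ∧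
      (∀ τ ∈ 𝔓.inertia (absoluteGaloisGroup ℚ), ∀ Q : geomPoints W, ℓ ^ k • Q = 0 →
        τ • Q - s τ • Q ∈ E₁) :=
  D3glob_multiplicativeFiltrationAt_of_local W ℓ k (D3loc_localToricFiltration W hv ℓ k) h𝔓

/-! ## X2 — Frobenius-norm test vectors for H5 / C0 (kernel-checked) -/

/-- X2a: `11a` (`a₃ = −1`; `11a3 → 11a2` is cyclic of degree `25`, kernel MIXED at `11`):
`n₁₂(3) = 3¹² + 1 − s₁₂(−1,3) = 532800 = 25·21312` — full level `25` holds here although the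
normal form only holds mod `5` (`r(Frob₃) = 16 (mod 25)`, of order `5`; `ε = 0`): both factors
`1 − α¹²`, `1 − β¹²` are `≡ 0 (mod 5)` because `ℓ − 1 = 4 ∣ 12`. -/
theorem X2a_frobNorm_11a_at_3 :
    (3 : ℤ) ^ 12 + 1 - Mazur1978.frobTracePow (-1) 3 12 = 25 * 21312 := by
  decide

/-- X2b: `14a` (`a₅ = 0`; cyclic `9`- and `18`-isogenies in the class):
`n₁₂(5) = 5¹² + 1 − 2·(−5)⁶ = 244109376 = 9·27123264`. -/
theorem X2b_frobNorm_14a_at_5 :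
    (5 : ℤ) ^ 12 + 1 - Mazur1978.frobTracePow 0 5 12 = 9 * 27123264 := by
  decide

end Summit.ABC.ABC.Cruxes.DefiniteRTControlPrime.Sketch.Ideas3g4
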